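import Summits.CriticalPhenomena.PercolationContinuityZ3.Theorems.FK.Transplant.QComparisonSums
import HarnessLib

/-!
# Strict comparison in `q`, 3/5: the `q`-derivative is dominated by the `p`-derivative — a static proof of the left inequality of Grimmett 2006 Prop. (3.28) eq. (3.29) with `α(p,q) = p(1-p)^Δ/(2Δ)`

Registered R71 (cell INBOX l.5302, 2026-08-23); registry row T1m; label T1m-C (coordinator fk-4 g139; adopted by the lead, L45 l.5303 = typer read NO OBJECTION at the statement layer); placement R71 (δ): all seven files of this package live under `Theorems/FK/Transplant/` (own-chain imports re-pointed; statements untouched).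
builds on p205010 (kernel theorem, internal audit signed; external expert review pending). Support file
(`--supports stmt-CriticalPhenomena-4575`, helper) typed by the FRONTIER TRANSPLANT seat `prim-bschramm-fkt-p2`
(`fk-continuity/transplant/`). No definitions, no named facts, no sorries; standard axioms.

HONEST FRAMING (page 1, cell rule). Everything in this file is UNCONDITIONAL finite-graph random-cluster theory
(`q ≥ 1`). It does NOT touch the transplant's theorem of record `ufsc0_of_freeBoundaryHypothesis_r3` (p248245,
« 2 / 0 ☑ »), which stays CONDITIONAL on FH AND TP_FK (open at the same `p` for `q > 1`; ⇔ GRC Conj. (5.103) via K1;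
barrier note `Literature.Barriers.CriticalPhenomena.SamePFreeBoundaryCriteria`); not a binder discharge, not a
re-cut, not `_r4`; `n_open = 2`, BINDER-OWNERS, FO-19 NO-GO unchanged. Purpose of the package
(`QComparisonClusterCount` → `QComparisonSums` → `QComparisonCovariance` → `QComparisonSegment` →
`CriticalPointStrictMono`): the second half of Grimmett 2006 Thm. (5.10) — `q ↦ p_c(q)` is STRICTLY increasing on
`[1, ∞)` for `d ≥ 2` — which `Theorems/FK/CriticalPointBounds.lean` records as "not in this file … needs Thm. (3.24),
not in the tree". The route is NOT the printed one: Grimmett proves Prop. (3.28) by a pair of coupled Markov chains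
([151] = Grimmett 1995); here the left inequality of (3.29) gets a STATIC proof (FKG for the increasing function
`N_W - 2k^B`, FKG on the graph with one edge removed, one-edge finite energy, independence of the edges inside the
wired set) with the explicit constant `α(p, q) = p(1-p)^Δ/(2Δ)`, and Thm. (3.24)'s contour function `γ` is replaced
by explicit admissible segments.

## Contents (namespace `Summit.CriticalPhenomena.PercolationContinuityZ3.Theorems.FK`)

§4 (unnormalised covariances `Cov(f, X) = Z·Σ w f X - (Σ w f)(Σ w X)` under `φ^B_{G,p,q}`, `X ≥ 0` increasing)
**`isolated_cov_ge_sum_edge_cov`** (GRC (3.39) summed over the edges at a vertex `x` of degree `≤ Δ`: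
`-Cov(1_{I_x}, X) ≥ ((1-p)^{Δ-1}/Δ) Σ_{e ∋ x} (-Cov(1_{C_e}, X))`),
**`sum_isolated_cov_le_two_mul_clusterCount_cov`** (`Σ_{x ∉ B} (-Cov(1_{I_x}, X)) ≤ 2(-Cov(k^B, X))`, FKG for
`N_W - 2k^B`), **`card_cov_le_sum_sum_edge_cov`** (`Cov(|η|, X) ≤ Σ_{x ∉ B} Σ_{e ∋ x} (-Cov(1_{C_e}, X))` when `X`
ignores the edges inside `B`), and the assembled **`card_cov_le_clusterCount_cov`**:
`((1-p)^{Δ-1}/(2Δ)) Cov(|η|, X) ≤ -Cov(k^B, X)`.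

## References

* G. Grimmett, *The Random-Cluster Model*, Springer 2006: §3.4 Thm. (3.21)–(3.24), Prop. (3.28) eq. (3.29) and its
  proof (3.36)–(3.39), proof of Thm. (3.24) (3.40)–(3.41), pp. 47–52; Thm. (3.1) eq. (3.3); Thm. 3.8 (FKG); §5.1
  Thm. (5.5), Thm. (5.10) and its proof (5.14)–(5.15), pp. 99–101. [Grimmett2006]
* G. R. Grimmett, *Comparison and disjoint-occurrence inequalities for random-cluster models*, J. Statist. Phys. 78
  (1995) 1311–1324 (Grimmett's [151]). [Grimmett1995]
-/

noncomputable section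

open scoped Classical
open MeasureTheory Finset SimpleGraph

namespace Summit.CriticalPhenomena.PercolationContinuityZ3.Theorems

namespace FK

open Literature.Probability.LatticeModels Literature.Probability.Percolation

/-! ### 4. The static comparison of the `q`- and `p`-covariances (Prop. (3.28), left inequality) -/

section Static
variable {V : Type*} [Fintype V] [DecidableEq V] {G : SimpleGraph V} [DecidableRel G.Adj]

/-- **Per-vertex estimate** (the static form of Grimmett's (3.39), summed over the edges at `x`): for a vertex
`x` of degree `≤ Δ` and an increasing `X ≥ 0`, with `I_x = {no open edge of G at x}` and `C_e = {e closed}`,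
`-cov(1_{I_x}, X) ≥ ((1-p)^{Δ-1}/Δ) Σ_{e ∋ x} (-cov(1_{C_e}, X))` (unnormalised covariances under `φ^B_{G,p,q}`,
`q ≥ 1`): closing the other `≤ Δ - 1` edges at `x` costs a factor `(1-p)^{Δ-1}` (finite energy) and only lowers
the conditional mean of `X` (FKG). [cite: Grimmett2006, proof of Prop. (3.28), eq. (3.39) p. 51] -/
theorem isolated_cov_ge_sum_edge_cov {p q : ℝ} (hp : p ∈ Set.Ioo (0 : ℝ) 1) (hq : 1 ≤ q) (B : Set V)
    {Δ : ℕ} {x : V} (hΔ : G.degree x ≤ Δ) {X : Finset (Sym2 V) → ℝ} (hX0 : 0 ≤ X) (hXm : Monotone X) :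
    (1 - p) ^ (Δ - 1) / Δ * ∑ e ∈ G.incidenceFinset x,
        ((∑ ω ∈ (G.edgeFinset.erase e).powerset, rcWeight G p q B ω) *
            (∑ ω ∈ G.edgeFinset.powerset, rcWeight G p q B ω * X ω) -
          (∑ ω ∈ G.edgeFinset.powerset, rcWeight G p q B ω) *
            ∑ ω ∈ (G.edgeFinset.erase e).powerset, rcWeight G p q B ω * X ω) ≤
      (∑ ω ∈ (G.edgeFinset \ G.incidenceFinset x).powerset, rcWeight G p q B ω) *
          (∑ ω ∈ G.edgeFinset.powerset, rcWeight G p q B ω * X ω) -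
        (∑ ω ∈ G.edgeFinset.powerset, rcWeight G p q B ω) *
          ∑ ω ∈ (G.edgeFinset \ G.incidenceFinset x).powerset, rcWeight G p q B ω * X ω := by
  have hpI : p ∈ Set.Icc (0 : ℝ) 1 := ⟨hp.1.le, hp.2.le⟩
  have hq0 : 0 < q := one_pos.trans_le hq
  have h1p : 0 ≤ 1 - p := sub_nonneg.2 hp.2.le
  set E := G.edgeFinset with hE
  set T := G.incidenceFinset x with hT
  set w := rcWeight G p q B with hw
  set Z := ∑ ω ∈ E.powerset, w ω with hZ
  set ZX := ∑ ω ∈ E.powerset, w ω * X ω with hZX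
  set a := ∑ ω ∈ (E \ T).powerset, w ω with ha
  set b := ∑ ω ∈ (E \ T).powerset, w ω * X ω with hb
  have hTE : T ⊆ E := G.incidenceFinset_subset x
  have hZ0 : 0 ≤ Z := sum_nonneg fun ω _ => rcWeight_nonneg G hpI hq0.le B ω
  -- the vertex term is nonnegative (FKG)
  have hV0 : 0 ≤ a * ZX - Z * b := by
    have := sum_mul_sum_sdiff_le G hpI hq B (subset_refl E) T hX0 hXm
    linarith
  -- per edge
  have hedge : ∀ e ∈ T,
      (1 - p) ^ (Δ - 1) * ((∑ ω ∈ (E.erase e).powerset, w ω) * ZX -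
          Z * ∑ ω ∈ (E.erase e).powerset, w ω * X ω) ≤ a * ZX - Z * b := by
    intro e he
    set c := ∑ ω ∈ (E.erase e).powerset, w ω with hc
    set dd := ∑ ω ∈ (E.erase e).powerset, w ω * X ω with hdd
    have hc0 : 0 < c := sum_powerset_rcWeight_pos G hpI hp.2 hq0 B _
    -- (i) FKG on the edge sets avoiding `e`: `c b ≤ dd a`
    have hsd : E.erase e \ T = E \ T := by
      rw [erase_sdiff_comm, erase_eq_of_notMem]
      exact fun h => (mem_sdiff.1 h).2 he
    have hi : c * b ≤ dd * a := by
      have := sum_mul_sum_sdiff_le G hpI hq B (erase_subset e E) T hX0 hXm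
      rwa [hsd] at this
    -- (ii) `U_e ≥ 0`
    have hU : Z * dd ≤ ZX * c := by
      have := sum_mul_sum_sdiff_le G hpI hq B (subset_refl E) {e} hX0 hXm
      rwa [sdiff_singleton_eq_erase] at this
    -- (iii) finite energy: `(1-p)^{Δ-1} c ≤ a`
    have hF : T.erase e ⊆ E.erase e := fun f hf =>
      mem_erase.2 ⟨(mem_erase.1 hf).1, hTE (mem_erase.1 hf).2⟩
    have hsd' : E.erase e \ T.erase e = E \ T := by
      ext f
      simp only [mem_sdiff, mem_erase, not_and]
      constructor
      · rintro ⟨⟨hfe, hfE⟩, h⟩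
        exact ⟨hfE, fun hfT => h hfe hfT⟩
      · rintro ⟨hfE, hfT⟩
        exact ⟨⟨fun h => hfT (h ▸ he), hfE⟩, fun _ h => hfT h⟩
    have hiii : (1 - p) ^ (Δ - 1) * c ≤ a := by
      have h1 := pow_mul_sum_powerset_le G hpI hq B (erase_subset e E) hF
      rw [hsd', card_erase_of_mem he] at h1
      have hcard : #T - 1 ≤ Δ - 1 := by
        rw [hT, card_incidenceFinset_eq_degree]; omega
      calc (1 - p) ^ (Δ - 1) * c ≤ (1 - p) ^ (#T - 1) * c :=
            mul_le_mul_of_nonneg_right (pow_le_pow_of_le_one h1p (sub_le_self 1 hp.1.le) hcard) hc0.le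
        _ ≤ a := h1
    -- combine: `c (aZX - Zb) ≥ a (cZX - Z dd) ≥ (1-p)^{Δ-1} c (cZX - Z dd)`
    have key : c * ((1 - p) ^ (Δ - 1) * (c * ZX - Z * dd)) ≤ c * (a * ZX - Z * b) := by
      have hUnn : 0 ≤ c * ZX - Z * dd := by linarith
      nlinarith [mul_nonneg hZ0 (sub_nonneg.2 hi), mul_nonneg (sub_nonneg.2 hiii) hUnn]
    exact le_of_mul_le_mul_left key hc0
  -- sum over the `≤ Δ` edges at `x`
  have hcardT : #T ≤ Δ := by rw [hT, card_incidenceFinset_eq_degree]; exact hΔ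
  have hsum : (1 - p) ^ (Δ - 1) * ∑ e ∈ T,
      ((∑ ω ∈ (E.erase e).powerset, w ω) * ZX - Z * ∑ ω ∈ (E.erase e).powerset, w ω * X ω) ≤
      Δ * (a * ZX - Z * b) := by
    rw [mul_sum]
    calc ∑ e ∈ T, (1 - p) ^ (Δ - 1) *
          ((∑ ω ∈ (E.erase e).powerset, w ω) * ZX - Z * ∑ ω ∈ (E.erase e).powerset, w ω * X ω)
        ≤ ∑ _e ∈ T, (a * ZX - Z * b) := sum_le_sum hedge
      _ = #T * (a * ZX - Z * b) := by rw [sum_const, nsmul_eq_mul]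
      _ ≤ Δ * (a * ZX - Z * b) := mul_le_mul_of_nonneg_right (Nat.cast_le.2 hcardT) hV0
  rcases Nat.eq_zero_or_pos Δ with hΔ0 | hΔ0
  · simp only [hΔ0, Nat.cast_zero, div_zero, zero_mul]
    exact hV0
  · have hΔr : (0 : ℝ) < Δ := Nat.cast_pos.2 hΔ0
    rw [div_mul_eq_mul_div, div_le_iff₀ hΔr]
    linarith

/-- **The isolated-vertex count against an increasing function** (FKG for the increasing function
`N_W - 2 k^B`, `W = V ∖ B`): `Σ_{x ∉ B} (-cov(1_{I_x}, X)) ≤ 2 (-cov(k^B, X))` (unnormalised covariances under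
`φ^B_{G,p,q}`, `q ≥ 1`, `X ≥ 0` increasing). [cite: Grimmett2006, proof of Prop. (3.28), eq. (3.37)–(3.38) p. 51] -/
theorem sum_isolated_cov_le_two_mul_clusterCount_cov {p q : ℝ} (hp : p ∈ Set.Icc (0 : ℝ) 1) (hq : 1 ≤ q)
    (B : Set V) {X : Finset (Sym2 V) → ℝ} (hX0 : 0 ≤ X) (hXm : Monotone X) :
    ∑ x ∈ univ.filter (fun x : V => x ∉ B),
        ((∑ ω ∈ (G.edgeFinset \ G.incidenceFinset x).powerset, rcWeight G p q B ω) *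
            (∑ ω ∈ G.edgeFinset.powerset, rcWeight G p q B ω * X ω) -
          (∑ ω ∈ G.edgeFinset.powerset, rcWeight G p q B ω) *
            ∑ ω ∈ (G.edgeFinset \ G.incidenceFinset x).powerset, rcWeight G p q B ω * X ω) ≤
      2 * ((∑ ω ∈ G.edgeFinset.powerset,
              rcWeight G p q B ω * (clusterCount (↑ω : BondConfig V) B : ℝ)) *
            (∑ ω ∈ G.edgeFinset.powerset, rcWeight G p q B ω * X ω) -
          (∑ ω ∈ G.edgeFinset.powerset, rcWeight G p q B ω) *
            ∑ ω ∈ G.edgeFinset.powerset, rcWeight G p q B ω *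
              ((clusterCount (↑ω : BondConfig V) B : ℝ) * X ω)) := by
  set E := G.edgeFinset with hE
  set w := rcWeight G p q B with hw
  set W := univ.filter (fun x : V => x ∉ B) with hW
  set N : Finset (Sym2 V) → ℝ := fun ω =>
    (Nat.card {x : V // x ∉ B ∧ ∀ z, z ≠ x → s(x, z) ∉ (↑ω : BondConfig V)} : ℝ) with hN
  set kk : Finset (Sym2 V) → ℝ := fun ω => (clusterCount (↑ω : BondConfig V) B : ℝ) with hkk
  set K0 : ℝ := (clusterCount ((↑(∅ : Finset (Sym2 V))) : BondConfig V) B : ℝ) with hK0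
  -- the increasing function `g = N - 2k + 2k(∅) ≥ 0`
  set g : Finset (Sym2 V) → ℝ := fun ω => N ω - 2 * kk ω + 2 * K0 with hg
  have hg0 : 0 ≤ g := fun ω => by
    simp only [hg, hN, hkk, hK0, Pi.zero_apply]
    have h1 : (clusterCount (↑ω : BondConfig V) B : ℝ) ≤
        clusterCount ((↑(∅ : Finset (Sym2 V))) : BondConfig V) B :=
      Nat.cast_le.2 (clusterCount_anti (Finset.coe_subset.2 (empty_subset ω)) B)
    have h2 : (0 : ℝ) ≤ Nat.card {x : V // x ∉ B ∧ ∀ z, z ≠ x → s(x, z) ∉ (↑ω : BondConfig V)} :=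
      Nat.cast_nonneg _
    linarith
  have hgm : Monotone g := by
    intro a b hab
    simp only [hg]
    have := monotone_card_isolated_sub_two_mul_clusterCount B hab
    simp only at this
    linarith
  have key := fkg_sum_powerset G hp hq B (subset_refl E) hX0 hg0 hXm hgm
  -- identify `Σ w N` and `Σ w X N` with the sums of the vertex terms
  have hNsum : ∀ ω ∈ E.powerset,
      N ω = ∑ x ∈ W, (if Disjoint (G.incidenceFinset x) ω then (1 : ℝ) else 0) :=
    fun ω hω => natCard_isolated_eq_sum G B (mem_powerset.1 hω)
  have e1 : ∑ ω ∈ E.powerset, w ω * N ω =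
      ∑ x ∈ W, ∑ ω ∈ (E \ G.incidenceFinset x).powerset, w ω := by
    calc ∑ ω ∈ E.powerset, w ω * N ω
        = ∑ ω ∈ E.powerset, ∑ x ∈ W, (if Disjoint (G.incidenceFinset x) ω then w ω else 0) := by
          refine sum_congr rfl fun ω hω => ?_
          rw [hNsum ω hω, mul_sum]
          exact sum_congr rfl fun x _ => by split_ifs <;> simp
      _ = ∑ x ∈ W, ∑ ω ∈ E.powerset, (if Disjoint (G.incidenceFinset x) ω then w ω else 0) := sum_comm
      _ = _ := sum_congr rfl fun x _ => sum_powerset_ite_disjoint E _ _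
  have e2 : ∑ ω ∈ E.powerset, w ω * (X ω * N ω) =
      ∑ x ∈ W, ∑ ω ∈ (E \ G.incidenceFinset x).powerset, w ω * X ω := by
    calc ∑ ω ∈ E.powerset, w ω * (X ω * N ω)
        = ∑ ω ∈ E.powerset, ∑ x ∈ W,
            (if Disjoint (G.incidenceFinset x) ω then w ω * X ω else 0) := by
          refine sum_congr rfl fun ω hω => ?_
          rw [hNsum ω hω, ← mul_assoc, mul_sum]
          exact sum_congr rfl fun x _ => by split_ifs <;> simp
      _ = ∑ x ∈ W, ∑ ω ∈ E.powerset,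
            (if Disjoint (G.incidenceFinset x) ω then w ω * X ω else 0) := sum_comm
      _ = _ := sum_congr rfl fun x _ => sum_powerset_ite_disjoint E _ _
  -- expand `g` in the FKG inequality
  have eg1 : ∑ ω ∈ E.powerset, w ω * g ω =
      ∑ ω ∈ E.powerset, w ω * N ω - 2 * ∑ ω ∈ E.powerset, w ω * kk ω +
        2 * K0 * ∑ ω ∈ E.powerset, w ω := by
    rw [mul_sum, mul_sum, ← sum_sub_distrib, ← sum_add_distrib]
    exact sum_congr rfl fun ω _ => by simp only [hg]; ring
  have eg2 : ∑ ω ∈ E.powerset, w ω * (X ω * g ω) =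
      ∑ ω ∈ E.powerset, w ω * (X ω * N ω) - 2 * ∑ ω ∈ E.powerset, w ω * (kk ω * X ω) +
        2 * K0 * ∑ ω ∈ E.powerset, w ω * X ω := by
    rw [mul_sum, mul_sum, ← sum_sub_distrib, ← sum_add_distrib]
    exact sum_congr rfl fun ω _ => by simp only [hg]; ring
  rw [eg1, eg2, e1, e2] at key
  rw [← hw] at key
  have e3 : ∑ x ∈ W, ((∑ ω ∈ (E \ G.incidenceFinset x).powerset, w ω) *
        (∑ ω ∈ E.powerset, w ω * X ω) -
      (∑ ω ∈ E.powerset, w ω) * ∑ ω ∈ (E \ G.incidenceFinset x).powerset, w ω * X ω) =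
      (∑ x ∈ W, ∑ ω ∈ (E \ G.incidenceFinset x).powerset, w ω) * (∑ ω ∈ E.powerset, w ω * X ω) -
        (∑ ω ∈ E.powerset, w ω) *
          ∑ x ∈ W, ∑ ω ∈ (E \ G.incidenceFinset x).powerset, w ω * X ω := by
    rw [sum_sub_distrib, sum_mul, mul_sum]
  rw [e3]
  linarith [key]

/-- **The edge terms add up to the `p`-covariance**, and an edge with both end points wired contributes
nothing: for an increasing `X ≥ 0` that does not depend on the edges inside `B`,
`cov(|η|, X) ≤ Σ_{x ∉ B} Σ_{e ∋ x} (-cov(1_{C_e}, X))` (unnormalised; every edge with an end point outside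
`B` is counted once or twice and has `-cov(1_{C_e}, X) ≥ 0`, the others have zero covariance because
their state is independent of the rest). [cite: Grimmett2006, proof of Prop. (3.28), eq. (3.36) and the display after (3.39) p. 51] -/
theorem card_cov_le_sum_sum_edge_cov {p q : ℝ} (hp : p ∈ Set.Ioo (0 : ℝ) 1) (hq : 1 ≤ q) (B : Set V)
    {X : Finset (Sym2 V) → ℝ} (hX0 : 0 ≤ X) (hXm : Monotone X)
    (hXB : ∀ ω : Finset (Sym2 V), ∀ e ∈ G.edgeFinset, (∀ x ∈ e, x ∈ B) → e ∉ ω → X (insert e ω) = X ω) :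
    (∑ ω ∈ G.edgeFinset.powerset, rcWeight G p q B ω) *
          (∑ ω ∈ G.edgeFinset.powerset, rcWeight G p q B ω * ((#ω : ℝ) * X ω)) -
        (∑ ω ∈ G.edgeFinset.powerset, rcWeight G p q B ω * (#ω : ℝ)) *
          (∑ ω ∈ G.edgeFinset.powerset, rcWeight G p q B ω * X ω) ≤
      ∑ x ∈ univ.filter (fun x : V => x ∉ B), ∑ e ∈ G.incidenceFinset x,
        ((∑ ω ∈ (G.edgeFinset.erase e).powerset, rcWeight G p q B ω) *
            (∑ ω ∈ G.edgeFinset.powerset, rcWeight G p q B ω * X ω) -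
          (∑ ω ∈ G.edgeFinset.powerset, rcWeight G p q B ω) *
            ∑ ω ∈ (G.edgeFinset.erase e).powerset, rcWeight G p q B ω * X ω) := by
  have hpI : p ∈ Set.Icc (0 : ℝ) 1 := ⟨hp.1.le, hp.2.le⟩
  have hq0 : 0 < q := one_pos.trans_le hq
  have h1p : (1 : ℝ) - p ≠ 0 := (sub_pos.2 hp.2).ne'
  set E := G.edgeFinset with hE
  set w := rcWeight G p q B with hw
  set W := univ.filter (fun x : V => x ∉ B) with hW
  set Z := ∑ ω ∈ E.powerset, w ω with hZ
  set ZX := ∑ ω ∈ E.powerset, w ω * X ω with hZX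
  set U : Sym2 V → ℝ := fun e =>
    (∑ ω ∈ (E.erase e).powerset, w ω) * ZX - Z * ∑ ω ∈ (E.erase e).powerset, w ω * X ω with hU
  -- each `U e ≥ 0`
  have hU0 : ∀ e, 0 ≤ U e := by
    intro e
    have := sum_mul_sum_sdiff_le G hpI hq B (subset_refl E) {e} hX0 hXm
    rw [sdiff_singleton_eq_erase] at this
    simp only [hU]
    linarith
  -- edges inside `B` contribute nothing
  have hUB : ∀ e ∈ E, (∀ x ∈ e, x ∈ B) → U e = 0 := by
    intro e he heB
    have he' : e ∈ G.edgeSet := mem_edgeFinset.1 he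
    have hk : ∀ ω : Finset (Sym2 V), e ∉ ω →
        clusterCount (↑(insert e ω) : BondConfig V) B = clusterCount (↑ω : BondConfig V) B := by
      intro ω _
      rw [coe_insert]
      revert he' heB
      induction e using Sym2.ind with
      | h u v =>
        intro heB he'
        exact clusterCount_insert_of_mem_wired _ B (G.ne_of_adj (by rwa [mem_edgeSet] at he'))
          (heB u (Sym2.mem_mk_left u v)) (heB v (Sym2.mem_mk_right u v))
    have h1 := (sum_mul_eq_of_clusterCount_insert G p q B he hk (fun ω hω => hXB ω e he heB hω)).1
    have h2 := (sum_mul_eq_of_clusterCount_insert G p q B he hk (X := fun _ => (1 : ℝ))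
      (fun _ _ => rfl)).1
    simp only [mul_one] at h2
    simp only [hU]
    rw [← h1, ← h2]
    ring
  -- the sum of all edge terms is the `p`-covariance
  have hcardsum : ∀ ω ∈ E.powerset, (#ω : ℝ) = ∑ e ∈ E, (if e ∈ ω then (1 : ℝ) else 0) := by
    intro ω hω
    rw [sum_boole, filter_mem_eq_inter, inter_eq_right.2 (mem_powerset.1 hω)]
  have hinner : ∀ ω ∈ E.powerset, ∑ e ∈ E, (if e ∈ ω then (0 : ℝ) else 1) = #E - (#ω : ℝ) := by
    intro ω hω
    rw [hcardsum ω hω, eq_sub_iff_add_eq, ← sum_add_distrib]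
    rw [show ∑ e ∈ E, ((if e ∈ ω then (0 : ℝ) else 1) + if e ∈ ω then (1 : ℝ) else 0) =
        ∑ _e ∈ E, (1 : ℝ) from sum_congr rfl fun e _ => by split_ifs <;> norm_num]
    simp
  have hc : ∑ e ∈ E, ∑ ω ∈ (E.erase e).powerset, w ω = ∑ ω ∈ E.powerset, w ω * (#E - (#ω : ℝ)) := by
    calc ∑ e ∈ E, ∑ ω ∈ (E.erase e).powerset, w ω
        = ∑ e ∈ E, ∑ ω ∈ E.powerset, (if e ∈ ω then (0 : ℝ) else 1) * w ω :=
          sum_congr rfl fun e _ => sum_powerset_erase_eq E e w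
      _ = ∑ ω ∈ E.powerset, ∑ e ∈ E, (if e ∈ ω then (0 : ℝ) else 1) * w ω := sum_comm
      _ = _ := sum_congr rfl fun ω hω => by rw [← sum_mul, hinner ω hω, mul_comm]
  have hd : ∑ e ∈ E, ∑ ω ∈ (E.erase e).powerset, w ω * X ω =
      ∑ ω ∈ E.powerset, w ω * X ω * (#E - (#ω : ℝ)) := by
    calc ∑ e ∈ E, ∑ ω ∈ (E.erase e).powerset, w ω * X ω
        = ∑ e ∈ E, ∑ ω ∈ E.powerset, (if e ∈ ω then (0 : ℝ) else 1) * (w ω * X ω) :=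
          sum_congr rfl fun e _ => sum_powerset_erase_eq E e (fun ω => w ω * X ω)
      _ = ∑ ω ∈ E.powerset, ∑ e ∈ E, (if e ∈ ω then (0 : ℝ) else 1) * (w ω * X ω) := sum_comm
      _ = _ := sum_congr rfl fun ω hω => by rw [← sum_mul, hinner ω hω, mul_comm]
  have hsumU : ∑ e ∈ E, U e = Z * (∑ ω ∈ E.powerset, w ω * ((#ω : ℝ) * X ω)) -
      (∑ ω ∈ E.powerset, w ω * (#ω : ℝ)) * ZX := by
    simp only [hU]
    rw [sum_sub_distrib, ← sum_mul, ← mul_sum, hc, hd]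
    have x1 : ∑ ω ∈ E.powerset, w ω * (#E - (#ω : ℝ)) = #E * Z - ∑ ω ∈ E.powerset, w ω * (#ω : ℝ) := by
      rw [hZ, mul_sum, ← sum_sub_distrib]
      exact sum_congr rfl fun ω _ => by ring
    have x2 : ∑ ω ∈ E.powerset, w ω * X ω * (#E - (#ω : ℝ)) =
        #E * ZX - ∑ ω ∈ E.powerset, w ω * ((#ω : ℝ) * X ω) := by
      rw [hZX, mul_sum, ← sum_sub_distrib]
      exact sum_congr rfl fun ω _ => by ring
    rw [x1, x2]
    ring
  -- double counting: every edge with an end point outside `B` occurs at least once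
  have hswap : ∑ x ∈ W, ∑ e ∈ G.incidenceFinset x, U e =
      ∑ e ∈ E, (#(W.filter fun x => x ∈ e) : ℝ) * U e := by
    calc ∑ x ∈ W, ∑ e ∈ G.incidenceFinset x, U e
        = ∑ x ∈ W, ∑ e ∈ E, (if x ∈ e then U e else 0) := by
          refine sum_congr rfl fun x _ => ?_
          rw [incidenceFinset_eq_filter, sum_filter]
      _ = ∑ e ∈ E, ∑ x ∈ W, (if x ∈ e then U e else 0) := sum_comm
      _ = _ := by
          refine sum_congr rfl fun e _ => ?_
          rw [← sum_filter, sum_const, nsmul_eq_mul]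
  change Z * (∑ ω ∈ E.powerset, w ω * ((#ω : ℝ) * X ω)) - (∑ ω ∈ E.powerset, w ω * (#ω : ℝ)) * ZX ≤
    ∑ x ∈ W, ∑ e ∈ G.incidenceFinset x, U e
  rw [hswap, ← hsumU]
  refine sum_le_sum fun e he => ?_
  by_cases h : ∃ x ∈ e, x ∉ B
  · obtain ⟨x, hxe, hxB⟩ := h
    have h1 : (1 : ℝ) ≤ #(W.filter fun x => x ∈ e) := by
      have hx : x ∈ W.filter fun x => x ∈ e := by simp [hW, hxB, hxe]
      exact_mod_cast card_pos.2 ⟨x, hx⟩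
    nlinarith [hU0 e]
  · have h' : ∀ x ∈ e, x ∈ B := fun x hx => by
      by_contra hxB
      exact h ⟨x, hx, hxB⟩
    rw [hUB e he h', mul_zero]

/-- **The `q`-derivative is dominated by the `p`-derivative (Grimmett 2006, Prop. (3.28), left inequality
of (3.29), in covariance form with an explicit constant).** For `p ∈ (0, 1)`, `q ≥ 1`, a wired set `B` all
of whose outside vertices have degree `≤ Δ`, and an increasing `X ≥ 0` that does not depend on the edges with
both end points in `B`:
`((1-p)^{Δ-1} / (2Δ)) · cov(|η|, X) ≤ -cov(k^B, X)` (unnormalised covariances under `φ^B_{G,p,q}`; recall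
`∂/∂p E(X) = cov(|η|, X)/(p(1-p))` and `∂/∂q E(X) = cov(k^B, X)/q`, Grimmett's (3.36)–(3.37)). The printed
proposition asserts SOME continuous `α(p, q) > 0`; this static proof (FKG and finite energy in place of the
coupled dynamics of [151]) gives `α = p (1-p)^Δ / (2Δ)`.
[cite: Grimmett2006, Prop. (3.28) eq. (3.29) (left inequality) p. 49] -/
theorem card_cov_le_clusterCount_cov {p q : ℝ} (hp : p ∈ Set.Ioo (0 : ℝ) 1) (hq : 1 ≤ q) (B : Set V)
    {Δ : ℕ} (hΔ : ∀ x, x ∉ B → G.degree x ≤ Δ) {X : Finset (Sym2 V) → ℝ} (hX0 : 0 ≤ X) (hXm : Monotone X)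
    (hXB : ∀ ω : Finset (Sym2 V), ∀ e ∈ G.edgeFinset, (∀ x ∈ e, x ∈ B) → e ∉ ω → X (insert e ω) = X ω) :
    (1 - p) ^ (Δ - 1) / (2 * Δ) *
        ((∑ ω ∈ G.edgeFinset.powerset, rcWeight G p q B ω) *
            (∑ ω ∈ G.edgeFinset.powerset, rcWeight G p q B ω * ((#ω : ℝ) * X ω)) -
          (∑ ω ∈ G.edgeFinset.powerset, rcWeight G p q B ω * (#ω : ℝ)) *
            (∑ ω ∈ G.edgeFinset.powerset, rcWeight G p q B ω * X ω)) ≤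
      (∑ ω ∈ G.edgeFinset.powerset, rcWeight G p q B ω * (clusterCount (↑ω : BondConfig V) B : ℝ)) *
          (∑ ω ∈ G.edgeFinset.powerset, rcWeight G p q B ω * X ω) -
        (∑ ω ∈ G.edgeFinset.powerset, rcWeight G p q B ω) *
          ∑ ω ∈ G.edgeFinset.powerset, rcWeight G p q B ω *
            ((clusterCount (↑ω : BondConfig V) B : ℝ) * X ω) := by
  have hpI : p ∈ Set.Icc (0 : ℝ) 1 := ⟨hp.1.le, hp.2.le⟩
  have h1p : 0 ≤ 1 - p := sub_nonneg.2 hp.2.le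
  have hA := card_cov_le_sum_sum_edge_cov (G := G) hp hq B hX0 hXm hXB
  have hB := sum_isolated_cov_le_two_mul_clusterCount_cov (G := G) hpI hq B hX0 hXm
  have hC : ∀ x ∈ univ.filter (fun x : V => x ∉ B), _ := fun x hx =>
    isolated_cov_ge_sum_edge_cov (G := G) hp hq B (hΔ x (mem_filter.1 hx).2) hX0 hXm
  have hC' := sum_le_sum hC
  rw [← mul_sum] at hC'
  have hκ : 0 ≤ (1 - p) ^ (Δ - 1) / Δ := div_nonneg (pow_nonneg h1p _) (Nat.cast_nonneg _)
  have h3 := mul_le_mul_of_nonneg_left hA hκ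
  have : (1 - p) ^ (Δ - 1) / (2 * Δ) = ((1 - p) ^ (Δ - 1) / Δ) / 2 := by ring
  rw [this]
  linarith
end Static

end FK

end Summit.CriticalPhenomena.PercolationContinuityZ3.Theorems

end
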